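import Summits.CriticalPhenomena.SAWScalingLimit.Theorems.LeftRightFKG.Negative.OrderCharacterisation
import Summits.CriticalPhenomena.SAWScalingLimit.Theorems.SAWLeftRightFKGLeftRightFKGStubMeshReduction
import Literature.Probability.RandomPlanarGeometry.LoopWinding
import HarnessLib

/-!
# Helpers for `FKGGivesDomainMonotone` (stmt-CriticalPhenomena-8256), part 2: the lens-winding relation
is a preorder

The hypothesis of `FKGGivesDomainMonotone` (= crux `LeftRightFKG`) and the conclusion `DomainMonotone` order
chords `γ₁, γ₂ : a → b` of a discrete domain by
`le γ₁ γ₂ :↔ ∀ z, 0 ≤ Curve.wind ⟨(γ₁.walk · γ₂.walk⁻¹).toCurve (meshPoint δ)⟩ z`.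
The conditioning lemma `law_le_law_of_posAssoc` (part 1) consumes `le` as a PREORDER.  Here this is proved
for walks of any lattice subgraph at any mesh `δ ≠ 0`, by reduction to the refuters' facewise
characterisation `wind_nonneg_iff_wcross` (mesh `1`, `Theorems/LeftRightFKG/Negative/OrderCharacterisation`)
through the scaling identities of `StubMeshReduction`:

* `curveWind_toCurve` — `Curve.wind` of a mesh polyline is the crux's `PlaneTopology.wind` of its
  `Set.IccExtend` (definitional);
* `lens_nonneg_iff_one` — non-negativity of the lens winding about every point is mesh independent;
* `lens_nonneg_iff_wcross` — at mesh `δ ≠ 0` it is facewise dominance `wcross m k w₁ ≤ wcross m k w₂` on any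
  box containing both walks;
* `exists_box` — finitely many walks lie in a common lattice box;
* `lens_refl`, `lens_trans` — the relation is reflexive and transitive (on walks of a lattice subgraph with
  common endpoints), in both the `Curve.wind` and the `Set.IccExtend` spelling.

Only theorems; axioms are the standard three. [folklore]
-/

noncomputable section

open Set Complex
open Literature.Probability.LatticeModels
open Literature.Probability.RandomPlanarGeometry
open Literature.Topology.PlaneTopology
open Summit.CriticalPhenomena.SAWScalingLimit.Theorems.LeftRightFKG.Negative (wcross wind_nonneg_iff_wcross)
open Summit.CriticalPhenomena.SAWScalingLimit.Theorems.LeftRightFKG.CornerLoc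
  (iccExtend_toCurve_meshPoint forall_wind_nonneg_iff)

namespace Summit.CriticalPhenomena.SAWScalingLimit.Theorems.SAWTargetMonotonicity.FKGGivesDomainMonotone

variable {G : SimpleGraph (Site 2)} {a b : Site 2}

/-- `Curve.wind` of the mesh polyline of a walk about `z` is the crux's `PlaneTopology.wind` of the clamped
polyline minus `z` (definitional unfolding of `Curve.wind`, `Curve.subPt`). [folklore] -/
theorem curveWind_toCurve {u v : Site 2} (w : G.Walk u v) (δ : ℝ) (z : ℂ) :
    Curve.wind ⟨w.toCurve (meshPoint δ)⟩ z =
      wind (fun t : ℝ => IccExtend zero_le_one (w.toCurve (meshPoint δ)) t - z) := rfl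

/-- **Mesh independence.**  The lens loop at mesh `δ ≠ 0` is `δ` times the lens loop at mesh `1`, so it winds
non-negatively about every point iff the mesh-`1` loop does. [folklore] -/
theorem lens_nonneg_iff_one {u v : Site 2} (w : G.Walk u v) {δ : ℝ} (hδ : δ ≠ 0) :
    (∀ z : ℂ, 0 ≤ wind (fun t : ℝ => IccExtend zero_le_one (w.toCurve (meshPoint δ)) t - z)) ↔
      ∀ z : ℂ, 0 ≤ wind (fun t : ℝ => IccExtend zero_le_one (w.toCurve (meshPoint 1)) t - z) := by
  have hδ' : (δ : ℂ) ≠ 0 := ofReal_ne_zero.2 hδ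
  rw [← forall_wind_nonneg_iff hδ' (fun t : ℝ => IccExtend zero_le_one (w.toCurve (meshPoint 1)) t)]
  refine forall_congr' fun z => ?_
  rw [show (fun t : ℝ => IccExtend zero_le_one (w.toCurve (meshPoint δ)) t - z) =
      fun t => (δ : ℂ) * IccExtend zero_le_one (w.toCurve (meshPoint 1)) t - z from
    funext fun t => by rw [iccExtend_toCurve_meshPoint]]

/-- **The lens order at mesh `δ ≠ 0` is facewise dominance of crossing counts** on any lattice box
containing both walks (`wind_nonneg_iff_wcross` transported along the scaling). [folklore] -/
theorem lens_nonneg_iff_wcross (hG : ∀ x y, G.Adj x y → (zdGraph 2).Adj x y) {δ : ℝ} (hδ : δ ≠ 0)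
    (w₁ w₂ : G.Walk a b) {X0 X1 Y0 Y1 : ℤ}
    (hb₁ : ∀ x ∈ w₁.support, (X0 ≤ x 0 ∧ x 0 ≤ X1) ∧ (Y0 ≤ x 1 ∧ x 1 ≤ Y1))
    (hb₂ : ∀ x ∈ w₂.support, (X0 ≤ x 0 ∧ x 0 ≤ X1) ∧ (Y0 ≤ x 1 ∧ x 1 ≤ Y1)) :
    (∀ z : ℂ, 0 ≤ wind (fun t : ℝ =>
        IccExtend zero_le_one ((w₁.append w₂.reverse).toCurve (meshPoint δ)) t - z)) ↔
      ∀ m k : ℤ, X0 ≤ m → m < X1 → Y0 ≤ k → k < Y1 → wcross m k w₁ ≤ wcross m k w₂ := by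
  rw [lens_nonneg_iff_one _ hδ]
  exact wind_nonneg_iff_wcross hG w₁ w₂ hb₁ hb₂

/-! ### A common bounding box -/

/-- Every finite list of sites lies in a lattice box `[-N, N]²`. [folklore] -/
theorem exists_bound_list (l : List (Site 2)) :
    ∃ N : ℤ, ∀ x ∈ l, (-N ≤ x 0 ∧ x 0 ≤ N) ∧ (-N ≤ x 1 ∧ x 1 ≤ N) := by
  induction l with
  | nil => exact ⟨0, fun x hx => by simp at hx⟩
  | cons y l ih =>
    obtain ⟨N, hN⟩ := ih
    refine ⟨max N (max |y 0| |y 1|), fun x hx => ?_⟩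
    rw [List.mem_cons] at hx
    rcases hx with rfl | hx
    · have h0 := abs_le.1 (le_max_left |x 0| |x 1|)
      have h1 := abs_le.1 (le_max_right |x 0| |x 1|)
      refine ⟨⟨?_, ?_⟩, ?_, ?_⟩ <;> omega
    · obtain ⟨⟨h1, h2⟩, h3, h4⟩ := hN x hx
      refine ⟨⟨?_, ?_⟩, ?_, ?_⟩ <;> omega

/-- Three walks lie in a common lattice box. [folklore] -/
theorem exists_box {u₁ v₁ u₂ v₂ u₃ v₃ : Site 2} (w₁ : G.Walk u₁ v₁) (w₂ : G.Walk u₂ v₂)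
    (w₃ : G.Walk u₃ v₃) :
    ∃ N : ℤ, (∀ x ∈ w₁.support, (-N ≤ x 0 ∧ x 0 ≤ N) ∧ (-N ≤ x 1 ∧ x 1 ≤ N)) ∧
      (∀ x ∈ w₂.support, (-N ≤ x 0 ∧ x 0 ≤ N) ∧ (-N ≤ x 1 ∧ x 1 ≤ N)) ∧
      (∀ x ∈ w₃.support, (-N ≤ x 0 ∧ x 0 ≤ N) ∧ (-N ≤ x 1 ∧ x 1 ≤ N)) := by
  obtain ⟨N, hN⟩ := exists_bound_list (w₁.support ++ w₂.support ++ w₃.support)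
  exact ⟨N, fun x hx => hN x (by simp [hx]), fun x hx => hN x (by simp [hx]),
    fun x hx => hN x (by simp [hx])⟩

/-! ### The lens relation is a preorder -/

/-- **Reflexivity**: the retraced loop `w · w⁻¹` winds non-negatively (in fact `0`) about every point.
[folklore] -/
theorem lens_refl (hG : ∀ x y, G.Adj x y → (zdGraph 2).Adj x y) {δ : ℝ} (hδ : δ ≠ 0)
    (w : G.Walk a b) :
    ∀ z : ℂ, 0 ≤ wind (fun t : ℝ =>
      IccExtend zero_le_one ((w.append w.reverse).toCurve (meshPoint δ)) t - z) := by
  obtain ⟨N, h₁, -, -⟩ := exists_box w w w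
  exact (lens_nonneg_iff_wcross hG hδ w w h₁ h₁).2 fun _ _ _ _ _ _ => le_rfl

/-- **Transitivity** of the lens relation `w₁ ≼ w₂ :↔ ∀ z, 0 ≤ wind(w₁ · w₂⁻¹ − z)` on walks of a lattice
subgraph with common endpoints (mesh `δ ≠ 0`). [folklore] -/
theorem lens_trans (hG : ∀ x y, G.Adj x y → (zdGraph 2).Adj x y) {δ : ℝ} (hδ : δ ≠ 0)
    (w₁ w₂ w₃ : G.Walk a b)
    (h₁₂ : ∀ z : ℂ, 0 ≤ wind (fun t : ℝ =>
      IccExtend zero_le_one ((w₁.append w₂.reverse).toCurve (meshPoint δ)) t - z))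
    (h₂₃ : ∀ z : ℂ, 0 ≤ wind (fun t : ℝ =>
      IccExtend zero_le_one ((w₂.append w₃.reverse).toCurve (meshPoint δ)) t - z)) :
    ∀ z : ℂ, 0 ≤ wind (fun t : ℝ =>
      IccExtend zero_le_one ((w₁.append w₃.reverse).toCurve (meshPoint δ)) t - z) := by
  obtain ⟨N, hb₁, hb₂, hb₃⟩ := exists_box w₁ w₂ w₃
  rw [lens_nonneg_iff_wcross hG hδ w₁ w₂ hb₁ hb₂] at h₁₂
  rw [lens_nonneg_iff_wcross hG hδ w₂ w₃ hb₂ hb₃] at h₂₃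
  exact (lens_nonneg_iff_wcross hG hδ w₁ w₃ hb₁ hb₃).2 fun m k hm hm' hk hk' =>
    (h₁₂ m k hm hm' hk hk').trans (h₂₃ m k hm hm' hk hk')

/-- Reflexivity in the `Curve.wind` spelling used by `FKGGivesDomainMonotone` / `DomainMonotone`.
[folklore] -/
theorem lens_refl' (hG : ∀ x y, G.Adj x y → (zdGraph 2).Adj x y) {δ : ℝ} (hδ : δ ≠ 0)
    (w : G.Walk a b) :
    ∀ z : ℂ, 0 ≤ Curve.wind ⟨(w.append w.reverse).toCurve (meshPoint δ)⟩ z :=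
  lens_refl hG hδ w

/-- Transitivity in the `Curve.wind` spelling used by `FKGGivesDomainMonotone` / `DomainMonotone`.
[folklore] -/
theorem lens_trans' (hG : ∀ x y, G.Adj x y → (zdGraph 2).Adj x y) {δ : ℝ} (hδ : δ ≠ 0)
    (w₁ w₂ w₃ : G.Walk a b)
    (h₁₂ : ∀ z : ℂ, 0 ≤ Curve.wind ⟨(w₁.append w₂.reverse).toCurve (meshPoint δ)⟩ z)
    (h₂₃ : ∀ z : ℂ, 0 ≤ Curve.wind ⟨(w₂.append w₃.reverse).toCurve (meshPoint δ)⟩ z) :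
    ∀ z : ℂ, 0 ≤ Curve.wind ⟨(w₁.append w₃.reverse).toCurve (meshPoint δ)⟩ z :=
  lens_trans hG hδ w₁ w₂ w₃ h₁₂ h₂₃

/-- The discrete domain graph is a lattice subgraph (the `hG` of the lemmas above). [folklore] -/
theorem discreteDomainGraph_adj_zd {Ω : Set ℂ} {δ : ℝ} :
    ∀ x y, (discreteDomainGraph Ω δ).Adj x y → (zdGraph 2).Adj x y :=
  fun _ _ h => meshGraph_le_zdGraph Ω δ (discreteDomainGraph_le_meshGraph Ω δ h)

end Summit.CriticalPhenomena.SAWScalingLimit.Theorems.SAWTargetMonotonicity.FKGGivesDomainMonotone
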